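import Literature.NumberTheory.EllipticCurves.HeathBrown1994.CongruentTwoSelmerMonskyMatrix
import Literature.NumberTheory.EllipticCurves.CongruentNumberCurveLSeriesProofs
import Literature.NumberTheory.EllipticCurves.AnalyticRankOrderProofs
import HarnessLib

/-!
# Monsky's matrix doors for `E_n : y² = x³ − n²x` WITHOUT the Deuring–Hecke leaf

Topic `Literature/NumberTheory/EllipticCurves/HeathBrown1994`, namespace `Literature.NumberTheory.EllipticCurves.HeathBrown1994`
(sequel to `CongruentTwoSelmerMonskyMatrix`). THEOREMS ONLY (no definition, no named fact).

The tree's journal doors `bsdTriple_of_monsky_of_BT_BF_odd/even` (p₁⋯p_k resp. 2p₁⋯p_k with Monsky determinant `1` ⟹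
`#Sel₂ = 4` ⟹ rank `0`, `Ш[2^∞] = 0` ⟹ `L(E_n, 1) ≠ 0` and the BSD triple) take FOUR named facts: Monsky's matrix theorem,
the Burungale–Tian rank-zero `p`-converse for CM curves, Burungale–Flach, and the Deuring–Hecke continuation
`hasEntireLFunction_of_j_mem_maximalCMJInvariants` (every CM curve with maximal CM has an entire `L`-function). The last one is
used only to know that `L(E_n, s)` is entire — and for the congruent number curves THAT is a theorem of the tree:
`hasEntireLFunction_congruentNumberCurve_holds` (`CongruentNumberCurveLSeriesProofs`: Ireland–Rosen Thm. 18.5/18.7 point count,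
`L(E_n, s) = ¼·` the weight-one theta `L`-series of `ℤ[i]`, Hecke's continuation — all proved). Hence the Deuring–Hecke leaf is
REDUNDANT for this family:

* `Smith2016.cor13_bsd_of_selmerRankTwo_of_burungaleTian_of_burungaleFlach_congruent` — Smith's Cor. 1.3 shape
  (`#Sel₂(E_n) = 4 ⟹ BSD triple`) from Burungale–Tian + Burungale–Flach ALONE;
* `L_one_ne_zero_congruentNumberCurve_of_card_selmerGroup_two` — `#Sel₂(E_n) = 4 ⟹ L(E_n, 1) ≠ 0` from Burungale–Tian alone;
* `bsdTriple_of_monsky_of_BT_BF_odd_congruent` / `…_even_congruent` — the journal doors with three named facts (Monsky,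
  Burungale–Tian, Burungale–Flach), same conclusions as the four-fact doors.

Every corner theorem of the BSD programme's `HeegnerTwistCouplingInSupply` layer stated «modulo five named facts» (Modularity for the
conductor, Monsky, Burungale–Tian, Deuring–Hecke, Burungale–Flach) therefore holds modulo FOUR by swapping the door. Nothing about
BSD in general is proved here.

## References
* D. R. Heath-Brown, *The size of Selmer groups for the congruent number problem, II*, Invent. Math. 118 (1994), Appendix by
  P. Monsky (typescript p. 39 L27–L33, p. 41 L20–L36). [HeathBrown1994SelmerCongruentII]
* A. Burungale, Y. Tian, *The even parity Goldfeld conjecture: congruent number elliptic curves*, Thm. 1.1. [BurungaleTian2026]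
* A. Burungale, M. Flach, *The conjecture of Birch and Swinnerton-Dyer for certain elliptic curves with complex multiplication*,
  Camb. J. Math. 12 (2024), Thm. 1.1, Cor. 2. [BurungaleFlach2024]
* N. Koblitz, *Introduction to Elliptic Curves and Modular Forms*, GTM 97, Ch. II §5, Theorem (p. 84). [KoblitzECMF1993]

## Mathlib / tree search
Tree: `hasEntireLFunction_congruentNumberCurve_holds`, `WeierstrassCurve.analyticRank_eq_zero_iff_holds`,
`Smith2016.{primaryComponent_sha_two_eq_bot_of_card_selmerGroup_two, mordellWeilRank_eq_zero_of_card_selmerGroup_two,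
cor13_bsd_of_selmerRankTwo, bsdTriple_congruentNumberCurve_of_cor13}`, `WeierstrassCurve.selmerCorank_eq_mordellWeilRank_add_holds`,
`finite_primaryComponent_sha_iff_shaCorank_eq_zero`, `LiLiuTian2024.hasCM_congruentNumberCurve`,
`HeathBrown1994.{bsdTriple_of_monsky_of_smith_odd/even, card_selmerGroup_two_eq_four_of_det_odd/even, squarefree_prod_of_injective,
squarefree_two_mul_prod_of_injective}`.
-/

noncomputable section

open scoped Classical

namespace Literature.NumberTheory.EllipticCurves

open WeierstrassCurve

/-- **`#Sel₂(E_n) = 4 ⟹ corank_{ℤ₂} Sel_{2^∞}(E_n) = 0`** (bookkeeping: rank `0` and `Ш[2^∞] = 0` by the tree's `2`-descent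
readings of Smith's hypothesis, then Greenberg's corank identity). [cite: Smith2016CongruentDensity, Cor. 1.3] [cite: Greenberg1999LNM, §1 pp. 54–57] -/
theorem selmerCorank_two_eq_zero_congruentNumberCurve_of_card_selmerGroup_two {n : ℕ} (hn : n ≠ 0)
    [(congruentNumberCurve n).IsElliptic] (hsel : Nat.card ((congruentNumberCurve n).selmerGroup 2) = 4) :
    (congruentNumberCurve n).selmerCorank 2 = 0 := by
  haveI : Fact (Nat.Prime 2) := ⟨Nat.prime_two⟩
  have hbot := Smith2016.primaryComponent_sha_two_eq_bot_of_card_selmerGroup_two hn hsel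
  have hfin : Finite (AddCommGroup.primaryComponent (congruentNumberCurve n).sha 2) := by
    rw [hbot]; infer_instance
  have hr := Smith2016.mordellWeilRank_eq_zero_of_card_selmerGroup_two hn hsel
  rw [(congruentNumberCurve n).selmerCorank_eq_mordellWeilRank_add_holds 2, hr,
    (finite_primaryComponent_sha_iff_shaCorank_eq_zero (congruentNumberCurve n) 2).1 hfin]

/-- **`#Sel₂(E_n) = 4 ⟹ L(E_n, 1) ≠ 0`, modulo Burungale–Tian ONLY** (`n` square-free): the rank-zero `2`-converse gives analytic
rank `0`, and `L(E_n, s)` is entire by the tree's theorem `hasEntireLFunction_congruentNumberCurve_holds` (no Deuring–Hecke leaf,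
no modularity). [cite: BurungaleTian2026, Thm. 1.1] [cite: KoblitzECMF1993, Ch. II §5, Theorem (p. 84)] -/
theorem L_one_ne_zero_congruentNumberCurve_of_card_selmerGroup_two
    (hBT : burungaleTian_analyticRank_eq_zero_of_selmerCorank_eq_zero_of_hasCM) {n : ℕ} (hsq : Squarefree n)
    [(congruentNumberCurve n).IsElliptic] (hsel : Nat.card ((congruentNumberCurve n).selmerGroup 2) = 4) :
    (congruentNumberCurve n).analyticRank = 0 ∧ (congruentNumberCurve n).entireLFunction 1 ≠ 0 := by
  haveI : Fact (Nat.Prime 2) := ⟨Nat.prime_two⟩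
  have h0 := hBT (congruentNumberCurve n) (LiLiuTian2024.hasCM_congruentNumberCurve n) 2
    (selmerCorank_two_eq_zero_congruentNumberCurve_of_card_selmerGroup_two hsq.ne_zero hsel)
  exact ⟨h0, (WeierstrassCurve.analyticRank_eq_zero_iff_holds (W := congruentNumberCurve n)
    (hasEntireLFunction_congruentNumberCurve_holds hsq)).1 h0⟩

/-- **Smith's Cor. 1.3 shape `#Sel₂(E_n) = 4 ⟹ BSD triple` from Burungale–Tian + Burungale–Flach ALONE** (the tree's
`Smith2016.cor13_bsd_of_selmerRankTwo_of_burungaleTian_of_burungaleFlach` with the Deuring–Hecke leaf discharged by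
`hasEntireLFunction_congruentNumberCurve_holds`). [cite: Smith2016CongruentDensity, Cor. 1.3] [cite: BurungaleTian2026, Thm. 1.1]
[cite: BurungaleFlach2024, Thm. 1.1 and Cor. 2] -/
theorem Smith2016.cor13_bsd_of_selmerRankTwo_of_burungaleTian_of_burungaleFlach_congruent
    (hBT : burungaleTian_analyticRank_eq_zero_of_selmerCorank_eq_zero_of_hasCM)
    (hBF : bsdTriple_of_hasCM_of_L_one_ne_zero) : Smith2016.cor13_bsd_of_selmerRankTwo := by
  intro n _ _ hsq hsel
  exact hBF (congruentNumberCurve n) (LiLiuTian2024.hasCM_congruentNumberCurve n)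
    (L_one_ne_zero_congruentNumberCurve_of_card_selmerGroup_two hBT hsq hsel).2

namespace HeathBrown1994

variable {k : ℕ} (p : Fin k → ℕ)

/-- **Journal door, odd `D = p₁⋯p_k`, THREE named facts** (Monsky, Burungale–Tian, Burungale–Flach): Monsky determinant `1` ⟹
BSD triple, rank `0`, analytic rank `0`, `L(E_D, 1) ≠ 0` and `Ш[2^∞] = 0`. Same conclusion as `bsdTriple_of_monsky_of_BT_BF_odd`
plus the `L`-value, without `hasEntireLFunction_of_j_mem_maximalCMJInvariants`.
[cite: HeathBrown1994SelmerCongruentII, Appendix (Monsky), typescript p. 39 L27–L33] [cite: BurungaleTian2026, Thm. 1.1]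
[cite: BurungaleFlach2024, Thm. 1.1 and Cor. 2] -/
theorem bsdTriple_of_monsky_of_BT_BF_odd_congruent (hM : monsky_card_selmerGroup_two_odd)
    (hBT : burungaleTian_analyticRank_eq_zero_of_selmerCorank_eq_zero_of_hasCM)
    (hBF : bsdTriple_of_hasCM_of_L_one_ne_zero) (hp : ∀ i, (p i).Prime) (hodd : ∀ i, Odd (p i))
    (hinj : Function.Injective p) (hdet : (monskyMatrixOdd p).det = 1) :
    haveI := isElliptic_congruentNumberCurve
      (Squarefree.ne_zero (squarefree_prod_of_injective p hp hinj))
    haveI := isGloballyMinimal_congruentNumberCurve (squarefree_prod_of_injective p hp hinj)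
    ((congruentNumberCurve (∏ i, p i)).BSDTriple ∧
      (congruentNumberCurve (∏ i, p i)).mordellWeilRank = 0 ∧
      (congruentNumberCurve (∏ i, p i)).analyticRank = 0) ∧
      (congruentNumberCurve (∏ i, p i)).entireLFunction 1 ≠ 0 ∧
      AddCommGroup.primaryComponent (congruentNumberCurve (∏ i, p i)).sha 2 = ⊥ := by
  have hsq := squarefree_prod_of_injective p hp hinj
  haveI := isElliptic_congruentNumberCurve hsq.ne_zero
  have hsel := card_selmerGroup_two_eq_four_of_det_odd p hM hp hodd hinj hdet
  exact ⟨bsdTriple_of_monsky_of_smith_odd p hM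
      (Smith2016.cor13_bsd_of_selmerRankTwo_of_burungaleTian_of_burungaleFlach_congruent hBT hBF) hp hodd hinj hdet,
    (L_one_ne_zero_congruentNumberCurve_of_card_selmerGroup_two hBT hsq hsel).2,
    Smith2016.primaryComponent_sha_two_eq_bot_of_card_selmerGroup_two hsq.ne_zero hsel⟩

/-- **Journal door, even `D = 2p₁⋯p_k`, THREE named facts** (as the odd case).
[cite: HeathBrown1994SelmerCongruentII, Appendix (Monsky), typescript p. 41 L20–L36] [cite: BurungaleTian2026, Thm. 1.1]
[cite: BurungaleFlach2024, Thm. 1.1 and Cor. 2] -/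
theorem bsdTriple_of_monsky_of_BT_BF_even_congruent (hM : monsky_card_selmerGroup_two_even)
    (hBT : burungaleTian_analyticRank_eq_zero_of_selmerCorank_eq_zero_of_hasCM)
    (hBF : bsdTriple_of_hasCM_of_L_one_ne_zero) (hp : ∀ i, (p i).Prime) (hodd : ∀ i, Odd (p i))
    (hinj : Function.Injective p) (hdet : (monskyMatrixEven p).det = 1) :
    haveI := isElliptic_congruentNumberCurve
      (Squarefree.ne_zero (squarefree_two_mul_prod_of_injective p hp hodd hinj))
    haveI := isGloballyMinimal_congruentNumberCurve
      (squarefree_two_mul_prod_of_injective p hp hodd hinj)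
    ((congruentNumberCurve (2 * ∏ i, p i)).BSDTriple ∧
      (congruentNumberCurve (2 * ∏ i, p i)).mordellWeilRank = 0 ∧
      (congruentNumberCurve (2 * ∏ i, p i)).analyticRank = 0) ∧
      (congruentNumberCurve (2 * ∏ i, p i)).entireLFunction 1 ≠ 0 ∧
      AddCommGroup.primaryComponent (congruentNumberCurve (2 * ∏ i, p i)).sha 2 = ⊥ := by
  have hsq := squarefree_two_mul_prod_of_injective p hp hodd hinj
  haveI := isElliptic_congruentNumberCurve hsq.ne_zero
  have hsel := card_selmerGroup_two_eq_four_of_det_even p hM hp hodd hinj hdet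
  exact ⟨bsdTriple_of_monsky_of_smith_even p hM
      (Smith2016.cor13_bsd_of_selmerRankTwo_of_burungaleTian_of_burungaleFlach_congruent hBT hBF) hp hodd hinj hdet,
    (L_one_ne_zero_congruentNumberCurve_of_card_selmerGroup_two hBT hsq hsel).2,
    Smith2016.primaryComponent_sha_two_eq_bot_of_card_selmerGroup_two hsq.ne_zero hsel⟩

end HeathBrown1994

end Literature.NumberTheory.EllipticCurves

end
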